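import Summits.ResolutionOfSingularities.ResolutionOfSingularities.Theorems.HilbertSamuelEliminationCampaignW42ToricMarkedTwoRay
import Summits.ResolutionOfSingularities.ResolutionOfSingularities.Theorems.HilbertSamuelEliminationCampaignW42ToricMarkedDescent

/-!
# [OURS · L1 W4.2] Toric marked monomial objects in dimension 3 — brick 9B: the TWO-RAY KERNEL (`Q₂` terminates and E-resolves)

[OURS · L1 W4.2 · seat res-L1-s42-pv-2 gen 6] replaces the role of the «k = 2 exact corner» sub-discipline of the σ-design cell inside
`stub_Wtop_elimination` (CHAIN w42 v3.22 §0u.3 (KR′), planner WORD (o-KR)/(d-δ) 2026-08-27T16:01:30Z); NOT a statement of the manuscript under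
review ([Hironaka2017] is a CANDIDATE, never a premise), nor of [CossartJannsenSaito2020], [Spivakovsky1983] or [Blanco 2012].  AI work, weaker than
expert review.

## What this file is

The 2-dimensional marked-monomial principalization / order reduction, in the id-model of brick 1 with a dummy ray (brick 9A): the
Dershowitz–Manna DESCENT STEP `nu_move_dm` (every `d`-avoiding blow-up all of whose children have smaller cone potential makes the measure `nu`
smaller), the ALLOWED-MOVE SET `Q2Allowed` (legal member singletons; the member pair of a cone that is non-principal — e.g. of positive residual
order, `q2Allowed_pair_of_thetaR_pos` / `_of_admissible` — or has both rays reduced) with the triple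
«every allowed move decreases `nu`» (`nu_dm_of_q2Allowed`) / «an unresolved cone admits an allowed move» (`exists_q2Allowed`) / invariants
(`Q2Allowed.invariants`) in the shape of the three-ray (d-α) triple, ONE STEP `exists_Q2_step`, and the **KERNEL THEOREM `eresolvable_avoiding`: every well-formed state with
non-negative exponents all of whose cones contain a dummy ray `d` with `a_d ≡ 0` is E-resolved by finitely many LEGAL blow-ups of faces not
containing `d`** (member faces only, no point move), with the initial-corner corollary `eresolvableAvoiding_initial` (a position one of whose three
exponent rows vanishes).  This is the restriction theorem asked for in (d-δ): «from a state whose generators vanish on ray `d`, the `d`-avoiding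
legal play E-resolves».  Nothing here is about schemes; nothing claims resolution of singularities in characteristic `p`.

Every `theorem` is fully proved; no `sorry`, no new axiom.
-/

set_option linter.dupNamespace false -- mandated namespace of this single-conjunct summit

namespace Summit.ResolutionOfSingularities.ResolutionOfSingularities.Theorems.CampaignW42.Toric

namespace TState

open Finset

variable {ι : Type} [Fintype ι] [Nonempty ι]

/-! ### The measure drops at every move all of whose children are smaller -/

/-- **DESCENT STEP.**  Let `R` be a face of a well-formed state and suppose every child `(C ∖ x) ∪ {ρ}` (`x ∈ R`) of every cone `C ⊇ R` has
strictly smaller potential than `C`.  Then the measure of the blown-up state is Dershowitz–Manna-below that of the state. -/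
theorem nu_move_dm {m : ℕ} {s : TState ι} (hwf : s.WF) {d : ℕ} {R : Finset ℕ} (hR : s.IsFace R)
    (HB : ∀ C ∈ s.cones, R ⊆ C → ∀ x ∈ R, (s.move m R).pot2 d (insert s.next (C.erase x)) < s.pot2 d C) :
    Descent.DM (· < ·) ((s.move m R).nu d) (s.nu d) := by
  classical
  set s' := s.move m R with hs'
  -- touched / untouched cones
  set I : Finset (Finset ℕ) := s.cones.filter (fun C => R ⊆ C) with hIdef
  set U : Finset (Finset ℕ) := s.cones.filter (fun C => ¬ R ⊆ C) with hUdef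
  set B : Finset ℕ → Multiset (ℕ ×ₗ ℕ) :=
    fun C => ((s'.cones).filter (fun D => ∃ x ∈ R, D = insert s.next (C.erase x))).val.map (s'.pot2 d) with hBdef
  -- (1) the old measure splits
  have hmu : s.nu d = U.val.map (s.pot2 d) + I.val.map (s.pot2 d) := by
    unfold nu
    rw [← Multiset.map_add]
    congr 1
    rw [hUdef, hIdef, Finset.filter_val, Finset.filter_val, add_comm]
    exact (Multiset.filter_add_not _ _).symm
  -- (2) some cone contains R
  have hI : I.val ≠ 0 := by
    obtain ⟨-, C, hC, hRC⟩ := hR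
    have hCI : C ∈ I := by rw [hIdef, Finset.mem_filter]; exact ⟨hC, hRC⟩
    intro h0
    have : C ∈ I.val := hCI
    rw [h0] at this
    exact Multiset.notMem_zero _ this
  -- (3) children are smaller
  have hBlt : ∀ C ∈ I.val, ∀ b ∈ B C, b < s.pot2 d C := by
    intro C hC b hb
    have hC' : C ∈ I := hC
    rw [hIdef, Finset.mem_filter] at hC'
    rw [hBdef] at hb
    simp only [Multiset.mem_map, Finset.mem_val, Finset.mem_filter] at hb
    obtain ⟨D, ⟨-, x, hx, rfl⟩, rfl⟩ := hb
    exact HB C hC'.1 hC'.2 x hx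
  -- (4) the new measure is dominated
  have hnew : ∀ D ∈ s'.cones, D ∈ U ∨ ∃ C ∈ I, D ∈ (s'.cones).filter (fun D => ∃ x ∈ R, D = insert s.next (C.erase x)) := by
    intro D hD
    have hD' := hD
    rw [hs', mem_move_cones] at hD'
    obtain ⟨C, hC, hDC⟩ := hD'
    by_cases hRC : R ⊆ C
    · right
      rw [children_of_subset hRC, Finset.mem_image] at hDC
      obtain ⟨x, hx, rfl⟩ := hDC
      refine ⟨C, ?_, ?_⟩
      · rw [hIdef, Finset.mem_filter]; exact ⟨hC, hRC⟩
      · rw [Finset.mem_filter]; exact ⟨hD, x, hx, rfl⟩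
    · left
      rw [children_of_not_subset hRC, Finset.mem_singleton] at hDC
      rw [hDC, hUdef, Finset.mem_filter]
      exact ⟨hC, hRC⟩
  have hsub : s'.cones ⊆ U ∪ I.biUnion (fun C => (s'.cones).filter (fun D => ∃ x ∈ R, D = insert s.next (C.erase x))) := by
    intro D hD
    rcases hnew D hD with hU | ⟨C, hC, hDC⟩
    · exact Finset.mem_union_left _ hU
    · exact Finset.mem_union_right _ (Finset.mem_biUnion.mpr ⟨C, hC, hDC⟩)
  have hUeq : U.val.map (s'.pot2 d) = U.val.map (s.pot2 d) := by
    apply Multiset.map_congr rfl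
    intro C hC
    have hC' : C ∈ U := hC
    rw [hUdef, Finset.mem_filter] at hC'
    exact pot2_move_of_not_mem (hwf.next_notMem hC'.1)
  have hle : s'.nu d ≤ U.val.map (s.pot2 d) + I.val.bind B := by
    unfold nu
    calc (s'.cones).val.map (s'.pot2 d)
        ≤ ((U ∪ I.biUnion (fun C => (s'.cones).filter
            (fun D => ∃ x ∈ R, D = insert s.next (C.erase x)))).val).map (s'.pot2 d) :=
          Multiset.map_le_map (Finset.val_le_iff.mpr hsub)
      _ ≤ (U.val + (I.biUnion (fun C => (s'.cones).filter
            (fun D => ∃ x ∈ R, D = insert s.next (C.erase x)))).val).map (s'.pot2 d) := by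
          apply Multiset.map_le_map
          rw [Finset.union_val]; exact Multiset.union_le_add _ _
      _ ≤ (U.val + I.val.bind (fun C => ((s'.cones).filter
            (fun D => ∃ x ∈ R, D = insert s.next (C.erase x))).val)).map (s'.pot2 d) := by
          apply Multiset.map_le_map
          rw [Finset.biUnion_val]
          exact add_le_add_right (Multiset.dedup_le (I.val.bind (fun C => ((s'.cones).filter
            (fun D => ∃ x ∈ R, D = insert s.next (C.erase x))).val))) _
      _ = U.val.map (s.pot2 d) + I.val.bind B := by
          rw [Multiset.map_add, hUeq, Multiset.map_bind]
  rw [hmu]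
  exact Descent.dm_of_le_replace _ _ _ _ hBlt hI hle

/-! ### Non-principal member pairs: the pair width is positive, so the pair move decreases unconditionally -/

/-- If the member pair of `C` is NOT principal (no generator is componentwise minimal on it), its pair width is positive
(contrapositive of brick 4A `exists_min_of_T_eq_zero`).  In particular every member pair of positive residual order has positive width. -/
theorem widthT_pos_of_not_principal {s : TState ι} {d : ℕ} {C : Finset ℕ} {a b : ℕ} (hab : a ≠ b) (hCab : C.erase d = {a, b})
    (hnp : ¬ s.Principal (C.erase d)) : 0 < s.widthT d C := by
  by_contra hT
  have hT0 : s.widthT d C = 0 := le_antisymm (le_of_not_gt hT) (widthT_nonneg s d C)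
  rw [widthT_eq hab hCab] at hT0
  obtain ⟨v₀, -, hmin⟩ := PairPot.exists_min_of_T_eq_zero (Finset.univ : Finset ι) Finset.univ_nonempty (s.expo a) (s.expo b) hT0
  apply hnp
  refine ⟨v₀, fun v r hr => ?_⟩
  rw [hCab, Finset.mem_insert, Finset.mem_singleton] at hr
  rcases hr with rfl | rfl
  · exact (hmin v (Finset.mem_univ v)).1
  · exact (hmin v (Finset.mem_univ v)).2

/-- A member pair of positive residual order is not principal (brick 3 `thetaR_eq_zero_iff_principal`). -/
theorem not_principal_of_thetaR_pos {s : TState ι} {R : Finset ℕ} (h : 0 < s.thetaR R) : ¬ s.Principal R :=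
  fun hp => (lt_irrefl (0 : ℤ)) (((thetaR_eq_zero_iff_principal s R).mpr hp) ▸ h)

/-- **PAIR MOVE, NON-PRINCIPAL CASE (no reducedness needed).**  If the member pair of the cone `C ∋ d` is legal and NOT principal, each child
of `C` under its blow-up has strictly smaller potential (the pair width drops, brick 4A non-principal case).  This covers every admissible member
pair of a phase `θs > 0` of procedure Q, whatever the member singletons do. -/
theorem pot2_pair_child_lt_of_not_principal {m : ℕ} {s : TState ι} (hwf : s.WF) {d : ℕ} (hd : s.DummyRay d)
    {C : Finset ℕ} (hC : C ∈ s.cones) (hnp : ¬ s.Principal (C.erase d)) {x : ℕ} (hx : x ∈ C.erase d) :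
    (s.move m (C.erase d)).pot2 d (insert s.next (C.erase x)) < s.pot2 d C := by
  have hnC : s.next ∉ C := hwf.next_notMem hC
  have hdC : d ∈ C := hd.1 C hC
  have hnd : s.next ≠ d := fun h => hnC (h ▸ hdC)
  obtain ⟨i, j, hij, hCd⟩ := hd.exists_pair hwf hC
  obtain ⟨b, hab, hCab⟩ : ∃ b, x ≠ b ∧ C.erase d = {x, b} := by
    have hxij : x ∈ ({i, j} : Finset ℕ) := hCd ▸ hx
    simp only [Finset.mem_insert, Finset.mem_singleton] at hxij
    rcases hxij with rfl | rfl
    · exact ⟨j, hij, hCd⟩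
    · exact ⟨i, hij.symm, by rw [hCd, Finset.pair_comm]⟩
  have had : x ≠ d := (Finset.mem_erase.mp hx).1
  have hbC : b ∈ C := Finset.mem_of_mem_erase (by rw [hCab]; simp : b ∈ C.erase d)
  have hbn : b ≠ s.next := fun h => hnC (h ▸ hbC)
  have hex : (s.move m (C.erase d)).expo s.next = fun v => s.expo x v + s.expo b v - m := by
    funext v; rw [move_expo_next, hCab]; unfold faceSum; rw [Finset.sum_pair hab]
  have heb : (s.move m (C.erase d)).expo b = s.expo b := funext (fun v => move_expo_of_ne hbn v)
  have hDd : (insert s.next (C.erase x)).erase d = {s.next, b} := by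
    rw [erase_child_eq hnd, hCab, pair_erase_left hab]
  have hTC : s.widthT d C = PairPot.T Finset.univ (s.expo x) (s.expo b) := widthT_eq hab hCab
  have hTD : (s.move m (C.erase d)).widthT d (insert s.next (C.erase x)) =
      PairPot.T Finset.univ (fun v => s.expo x v + s.expo b v - m) (s.expo b) := by
    rw [widthT_eq hbn.symm hDd, hex, heb]
  have hT : 0 < s.widthT d C := widthT_pos_of_not_principal hab hCab hnp
  unfold pot2
  refine Prod.Lex.lt_iff.mpr (Or.inl ?_)
  have hlt : (s.move m (C.erase d)).widthT d (insert s.next (C.erase x)) < s.widthT d C := by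
    rw [hTD, hTC]; rw [hTC] at hT; exact PairPot.T_child2_lt _ _ _ _ hT
  have h0 := widthT_nonneg (s.move m (C.erase d)) d (insert s.next (C.erase x))
  exact (Int.toNat_lt_toNat (by omega)).mpr hlt

/-! ### The allowed moves of the two-ray discipline and one step -/

/-- **[OURS · L1 W4.2]** The `Q₂`-ALLOWED moves at a dummy-ray state (free choice inside this set): a LEGAL face not containing `d` which is
either a member SINGLETON, or the member PAIR `C ∖ d` of a cone `C` that is NOT principal there (positive residual order — every pair move of a
phase `θs > 0`) or none of whose two member singletons is legal (both rays reduced — the `β`-minimal legal member face of phase `0`).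
(The shape `(allowed, measure, decrease, existence)` matches the (d-α) triple of the three-ray discipline.) -/
def Q2Allowed (m d : ℕ) (s : TState ι) (R : Finset ℕ) : Prop :=
  s.Legal m R ∧ d ∉ R ∧
    ((∃ a, R = {a}) ∨ ∃ C ∈ s.cones, R = C.erase d ∧ ((∀ r ∈ R, ¬ s.Legal m {r}) ∨ ¬ s.Principal R))

omit [Fintype ι] [Nonempty ι] in
/-- An allowed move is legal. -/
theorem Q2Allowed.legal {m d : ℕ} {s : TState ι} {R : Finset ℕ} (h : s.Q2Allowed m d R) : s.Legal m R := h.1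

omit [Fintype ι] [Nonempty ι] in
/-- An allowed move avoids the dummy ray. -/
theorem Q2Allowed.not_mem {m d : ℕ} {s : TState ι} {R : Finset ℕ} (h : s.Q2Allowed m d R) : d ∉ R := h.2.1

omit [Fintype ι] [Nonempty ι] in
/-- A cone of a well-formed dummy-ray state containing the member pair of another cone is that cone. -/
theorem DummyRay.eq_of_erase_subset {d : ℕ} {s : TState ι} (hd : s.DummyRay d) (hwf : s.WF) {C₀ C : Finset ℕ} (hC₀ : C₀ ∈ s.cones)
    (hC : C ∈ s.cones) (h : C₀.erase d ⊆ C) : C₀ = C := by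
  have hsub : C₀ ⊆ C := by
    rw [← Finset.insert_erase (hd.1 C₀ hC₀)]
    exact Finset.insert_subset (hd.1 C hC) h
  exact Finset.eq_of_subset_of_card_le hsub (by rw [(hwf C hC).1, (hwf C₀ hC₀).1])

/-- **DECREASE: every `Q₂`-allowed move makes the measure Dershowitz–Manna-smaller** (singleton = translation at every cone through the ray;
pair = the two children of the unique cone through the pair, brick 9A). -/
theorem nu_dm_of_q2Allowed {m : ℕ} (hm : 0 < m) {s : TState ι} (hwf : s.WF) (hnn : s.Nonneg) {d : ℕ} (hd : s.DummyRay d)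
    {R : Finset ℕ} (h : s.Q2Allowed m d R) : Descent.DM (· < ·) ((s.move m R).nu d) (s.nu d) := by
  obtain ⟨hlegal, hdR, hkind⟩ := h
  refine nu_move_dm hwf hlegal.1 ?_
  intro C hC hRC x hx
  rcases hkind with ⟨a, rfl⟩ | ⟨C₀, hC₀, rfl, hkind⟩
  · rw [Finset.mem_singleton] at hx
    rw [hx]
    have had : a ≠ d := fun h => hdR (by rw [h]; exact Finset.mem_singleton_self d)
    exact pot2_singleton_child_lt hm hnn hwf hd hC (Finset.singleton_subset_iff.mp hRC) had hlegal
  · have hCeq : C₀ = C := hd.eq_of_erase_subset hwf hC₀ hC hRC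
    subst hCeq
    rcases hkind with hred | hnp
    · exact pot2_pair_child_lt hnn hwf hd hC₀ hred hlegal hx
    · exact pot2_pair_child_lt_of_not_principal hwf hd hC₀ hnp hx

omit [Fintype ι] [Nonempty ι] in
/-- **EXISTENCE: an unresolved cone admits a `Q₂`-allowed move** — a legal member singleton if there is one, else its member pair
(legal because `a_d ≡ 0` and the cone is unresolved). -/
theorem exists_q2Allowed {m : ℕ} {s : TState ι} (hwf : s.WF) {d : ℕ} (hd : s.DummyRay d) (hex : ∃ C ∈ s.cones, ¬ s.Resolved m C) :
    ∃ R, s.Q2Allowed m d R := by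
  obtain ⟨C₀, hC₀, hnr⟩ := hex
  obtain ⟨a, b, hab, hCab⟩ := hd.exists_pair hwf hC₀
  have ha : a ∈ C₀.erase d := by rw [hCab]; simp
  have hb : b ∈ C₀.erase d := by rw [hCab]; simp
  have hdR : d ∉ C₀.erase d := fun h => (Finset.mem_erase.mp h).1 rfl
  have hnot : ∀ r ∈ C₀.erase d, d ∉ ({r} : Finset ℕ) := by
    intro r hr h
    rw [Finset.mem_singleton] at h
    exact hdR (h ▸ hr)
  by_cases hla : s.Legal m {a}
  · exact ⟨{a}, hla, hnot a ha, Or.inl ⟨a, rfl⟩⟩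
  by_cases hlb : s.Legal m {b}
  · exact ⟨{b}, hlb, hnot b hb, Or.inl ⟨b, rfl⟩⟩
  have hred : ∀ r ∈ C₀.erase d, ¬ s.Legal m {r} := by
    intro r hr
    rw [hCab, Finset.mem_insert, Finset.mem_singleton] at hr
    rcases hr with rfl | rfl
    · exact hla
    · exact hlb
  have hlegal : s.Legal m (C₀.erase d) := by
    refine ⟨⟨⟨a, ha⟩, C₀, hC₀, Finset.erase_subset d C₀⟩, fun v => ?_⟩
    rw [hd.faceSum_erase hC₀ v]
    exact not_lt.mp (fun h => hnr ⟨v, h⟩)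
  exact ⟨C₀.erase d, hlegal, hdR, Or.inr ⟨C₀, hC₀, rfl, Or.inl hred⟩⟩

omit [Fintype ι] [Nonempty ι] in
/-- Every legal member singleton is `Q₂`-allowed. -/
theorem q2Allowed_singleton {m d : ℕ} {s : TState ι} {a : ℕ} (hlegal : s.Legal m {a}) (had : a ≠ d) : s.Q2Allowed m d {a} :=
  ⟨hlegal, by rw [Finset.mem_singleton]; exact had.symm, Or.inl ⟨a, rfl⟩⟩

/-- **Every legal member pair of positive residual order is `Q₂`-allowed** (so the kernel covers every pair step of a phase `θs > 0` of
procedure Q restricted to member faces, admissible or not, whatever the member singletons do). -/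
theorem q2Allowed_pair_of_thetaR_pos {m d : ℕ} {s : TState ι} {C : Finset ℕ} (hC : C ∈ s.cones) (hlegal : s.Legal m (C.erase d))
    (hθ : 0 < s.thetaR (C.erase d)) : s.Q2Allowed m d (C.erase d) :=
  ⟨hlegal, fun h => (Finset.mem_erase.mp h).1 rfl, Or.inr ⟨C, hC, rfl, Or.inr (not_principal_of_thetaR_pos hθ)⟩⟩

/-- Every ADMISSIBLE member pair of a positive phase is `Q₂`-allowed. -/
theorem q2Allowed_pair_of_admissible {m d : ℕ} {s : TState ι} (hnn : s.Nonneg) {θs : ℤ} (hθ : 0 < θs) {C : Finset ℕ} (hC : C ∈ s.cones)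
    (hadm : s.Admissible m θs (C.erase d)) : s.Q2Allowed m d (C.erase d) :=
  q2Allowed_pair_of_thetaR_pos hC (hadm.legal hnn) (by rw [hadm.2.1]; exact hθ)

omit [Fintype ι] [Nonempty ι] in
/-- In a dummy-ray state the member pair of an UNRESOLVED cone is legal (`a_d ≡ 0`). -/
theorem DummyRay.legal_erase_of_not_resolved {m d : ℕ} {s : TState ι} (hd : s.DummyRay d) (hwf : s.WF) {C : Finset ℕ} (hC : C ∈ s.cones)
    (hnr : ¬ s.Resolved m C) : s.Legal m (C.erase d) := by
  obtain ⟨a, b, -, hCab⟩ := hd.exists_pair hwf hC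
  refine ⟨⟨⟨a, by rw [hCab]; simp⟩, C, hC, Finset.erase_subset d C⟩, fun v => ?_⟩
  rw [hd.faceSum_erase hC v]
  exact not_lt.mp (fun h => hnr ⟨v, h⟩)

/-- **ONE STEP OF `Q₂`.**  In a well-formed non-negative dummy-ray state with an unresolved cone, some `d`-avoiding LEGAL blow-up makes the
measure Dershowitz–Manna-smaller. -/
theorem exists_Q2_step {m : ℕ} (hm : 0 < m) {s : TState ι} (hwf : s.WF) (hnn : s.Nonneg) {d : ℕ} (hd : s.DummyRay d)
    (hex : ∃ C ∈ s.cones, ¬ s.Resolved m C) :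
    ∃ R, s.Legal m R ∧ d ∉ R ∧ Descent.DM (· < ·) ((s.move m R).nu d) (s.nu d) := by
  obtain ⟨R, hR⟩ := exists_q2Allowed hwf hd hex
  exact ⟨R, hR.legal, hR.not_mem, nu_dm_of_q2Allowed hm hwf hnn hd hR⟩

omit [Fintype ι] [Nonempty ι] in
/-- The invariants survive every allowed move. -/
theorem Q2Allowed.invariants {m d : ℕ} {s : TState ι} {R : Finset ℕ} (h : s.Q2Allowed m d R) (hwf : s.WF) (hnn : s.Nonneg)
    (hd : s.DummyRay d) : (s.move m R).WF ∧ (s.move m R).Nonneg ∧ (s.move m R).DummyRay d :=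
  ⟨hwf.move R, hnn.move h.legal, hd.move hwf h.legal.1 h.not_mem⟩

/-! ### The kernel theorem -/

/-- **[OURS · L1 W4.2] THE TWO-RAY KERNEL.**  Every well-formed state with non-negative exponents all of whose cones contain a dummy ray `d`
with `a_d ≡ 0` is E-resolvable by the two-ray discipline: finitely many LEGAL blow-ups of faces NOT containing `d` (member singletons and member
pairs only, no point move) reach a state all of whose corners are E-resolved.  (2-dimensional marked-monomial order reduction.) -/
theorem eresolvable_avoiding {m : ℕ} (hm : 0 < m) (s : TState ι) (hwf : s.WF) (hnn : s.Nonneg) {d : ℕ} (hd : s.DummyRay d) :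
    s.EResolvableAvoiding m d := by
  classical
  have wf := (Descent.wellFounded_dm (r := fun a b : ℕ ×ₗ ℕ => a < b) wellFounded_lt)
  suffices H : ∀ (M : Multiset (ℕ ×ₗ ℕ)) (s : TState ι), s.nu d = M → s.WF → s.Nonneg → s.DummyRay d →
      s.EResolvableAvoiding m d from H _ s rfl hwf hnn hd
  intro M
  induction M using wf.induction with
  | _ M ih =>
    intro s hsM hwf hnn hd
    by_cases hex : ∃ C ∈ s.cones, ¬ s.Resolved m C
    · obtain ⟨R, hlegal, hdR, hdm⟩ := exists_Q2_step hm hwf hnn hd hex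
      rw [hsM] at hdm
      obtain ⟨t, hplay, ht⟩ := ih _ hdm (s.move m R) rfl (hwf.move R) (hnn.move hlegal) (hd.move hwf hlegal.1 hdR)
      exact ⟨t, PlayAvoid.step R hlegal hdR hplay, ht⟩
    · refine ⟨s, PlayAvoid.refl s, fun C hC => ?_⟩
      by_contra h
      exact hex ⟨C, hC, h⟩

/-- **Corollary (with the invariants of the end state).**  The E-resolved end state of the two-ray discipline is again a well-formed non-negative
dummy-ray state (the dummy ray is never touched). -/
theorem eresolvable_avoiding' {m : ℕ} (hm : 0 < m) (s : TState ι) (hwf : s.WF) (hnn : s.Nonneg) {d : ℕ} (hd : s.DummyRay d) :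
    ∃ t, s.PlayAvoid m d t ∧ t.EResolved m ∧ t.WF ∧ t.Nonneg ∧ t.DummyRay d := by
  obtain ⟨t, hplay, ht⟩ := eresolvable_avoiding hm s hwf hnn hd
  exact ⟨t, hplay, ht, DummyRay.playAvoid hplay hwf hnn hd⟩

omit [Fintype ι] [Nonempty ι] in
/-- The initial corner of a position one of whose exponent rows vanishes is a dummy-ray state for that row. -/
theorem dummyRay_initial (a : Fin 3 → ι → ℤ) (k : Fin 3) (hk : ∀ v, a k v = 0) : (initial a).DummyRay k.val := by
  refine ⟨fun C hC => ?_, fun v => ?_⟩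
  · simp only [initial, Finset.mem_singleton] at hC
    subst hC
    have := k.isLt
    simp only [Finset.mem_insert, Finset.mem_singleton]
    omega
  · show (if h : (k : ℕ) < 3 then a ⟨k, h⟩ v else 0) = 0
    rw [dif_pos k.isLt]
    exact hk v

/-- **Corollary (initial `k = 2` corner).**  A position with non-negative exponents one of whose three rows vanishes (a corner with two member
rays and one dummy coordinate) is E-resolvable from its initial corner by the two-ray discipline off that row. -/
theorem eresolvableAvoiding_initial {m : ℕ} (hm : 0 < m) (a : Fin 3 → ι → ℤ) (ha : ∀ k v, 0 ≤ a k v) (k : Fin 3)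
    (hk : ∀ v, a k v = 0) : (initial a).EResolvableAvoiding m k.val :=
  eresolvable_avoiding hm _ (initial_WF a) (initial_nonneg a ha) (dummyRay_initial a k hk)

end TState

end Summit.ResolutionOfSingularities.ResolutionOfSingularities.Theorems.CampaignW42.Toric
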